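import Summits.HubbardSuperconductivity.HubbardSuperconductivity.Theorems.DeformationLadderLadderThesisPinnedFrameIsospectral
import Summits.HubbardSuperconductivity.HubbardSuperconductivity.Theorems.DeformationLadderLadderThesisRigidityReduction
import HarnessLib

/-!
# Pinned spin-↑ gauge frame for `LadderThesis` (stmt-HubbardSuperconductivity-1890) — the
# orbit-averaged converse: a penalty gap pins SOME nonzero frame

* `sum_frameEnergy_sub_le`, `exists_frameEnergy_sub_le`, `exists_pinnedFrame_of_ladderThesis` —
  the orbit-averaged converse: `Σ_k (e(k) - E₀) ≤ 32 s`, so some `k ≠ 0` has `e(k) - E₀ ≤ 32s/(L²-1)`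
  and `LadderThesis` pins SOME nonzero frame by `(a/2)s`.


References: Kaplan–Horsch–von der Linden, J. Phys. Soc. Jpn. 58 (1989) 3894; Tasaki (2020) §2.1–2.2;
Kennedy–Lieb–Shastry, PRL 61 (1988) 2582 (sum rule).
-/

noncomputable section

namespace Summit.HubbardSuperconductivity.HubbardSuperconductivity.Theorems.PinnedFrame

set_option linter.dupNamespace false

open Matrix Finset Complex Literature.MathematicalPhysics.QuantumLattice
  Literature.Probability.LatticeModels HubbardWave0
open scoped ComplexOrder ComplexConjugate Matrix.Norms.L2Operator

variable (L : ℕ) [NeZero L]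

/-! ### The converse direction: a penalty gap pins SOME frame (orbit average) -/

open Summit.HubbardSuperconductivity.HubbardSuperconductivity.Theses.DeformationLadder
  Summit.HubbardSuperconductivity.HubbardSuperconductivity.Theorems.DeformationLadder in
/-- **Orbit-averaged variational ceiling on the frame energies.** With `E₀ = minEnergyOn H_L (2n,0)`
and `e(k) = minEnergyOn (H_L + (s/L⁴) Δ↑_d(k)ᴴΔ↑_d(k)) (2n,0)` (`s ≥ 0`, `n ≤ L²`):
`Σ_k (e(k) - E₀) ≤ 32 s` — test every frame with one unit sector ground state `ψ₀` of `H_L`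
(`e(k) ≤ E₀ + (s/L⁴)⟨Δ↑_d(k)ᴴΔ↑_d(k)⟩_{ψ₀}`) and use the orbit bound `Σ_k ⟨Δ↑_d(k)ᴴΔ↑_d(k)⟩_{ψ₀} ≤ 32L⁴`.
Hence at most an `O(s/L²)` fraction of the frames can be pinned by more than `O(1)·s`. [folklore] -/
theorem sum_frameEnergy_sub_le (U : ℝ) {s : ℝ} (hs : 0 ≤ s) {n : ℕ} (hn : n ≤ L ^ 2) :
    ∑ k : TorusSite 2 L,
        ((hubbardTorus 2 L 1 U + ((s / (L : ℝ) ^ 4 : ℝ) : ℂ) •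
            ((upPairFieldAt dWaveFormFactor L k)ᴴ * upPairFieldAt dWaveFormFactor L k)).minEnergyOn
            (szSector (2 * n) 0) -
          (hubbardTorus 2 L 1 U).minEnergyOn (szSector (2 * n) 0)) ≤ 32 * s := by
  -- a unit sector ground state of the unpenalised torus
  obtain ⟨ψ, hψ1, hmem, -, heig⟩ := penalisedGroundStateExists_proof L U 0 n hn
  simp only [Complex.ofReal_zero, zero_smul, add_zero] at hmem heig
  set E₀ := (hubbardTorus 2 L 1 U).minEnergyOn (szSector (2 * n) 0) with hE₀
  have hL4 : (0 : ℝ) < (L : ℝ) ^ 4 := by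
    have : (0 : ℝ) < L := by exact_mod_cast Nat.pos_of_ne_zero (NeZero.ne L)
    positivity
  -- each frame, tested on `ψ`
  have hk : ∀ k : TorusSite 2 L,
      (hubbardTorus 2 L 1 U + ((s / (L : ℝ) ^ 4 : ℝ) : ℂ) •
          ((upPairFieldAt dWaveFormFactor L k)ᴴ * upPairFieldAt dWaveFormFactor L k)).minEnergyOn
          (szSector (2 * n) 0) - E₀ ≤
        s / (L : ℝ) ^ 4 * (star ψ ⬝ᵥ (((upPairFieldAt dWaveFormFactor L k)ᴴ *
          upPairFieldAt dWaveFormFactor L k) *ᵥ ψ)).re := by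
    intro k
    have hH : (hubbardTorus 2 L 1 U + ((s / (L : ℝ) ^ 4 : ℝ) : ℂ) •
        ((upPairFieldAt dWaveFormFactor L k)ᴴ * upPairFieldAt dWaveFormFactor L k)).IsHermitian :=
      isHermitian_add_real_smul_penalty (LiebThm1.hamiltonian_isHermitian _ 1 U) _ _
    have hle := minEnergyOn_le_rayleigh_of_mem hH (szSector (2 * n) 0) hmem hψ1
    rw [add_mulVec, dotProduct_add, Complex.add_re, heig, dotProduct_smul, smul_eq_mul, hψ1, mul_one,
      Complex.ofReal_re, smul_mulVec, dotProduct_smul, smul_eq_mul, Complex.re_ofReal_mul] at hle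
    linarith
  calc ∑ k : TorusSite 2 L, ((hubbardTorus 2 L 1 U + ((s / (L : ℝ) ^ 4 : ℝ) : ℂ) •
          ((upPairFieldAt dWaveFormFactor L k)ᴴ * upPairFieldAt dWaveFormFactor L k)).minEnergyOn
          (szSector (2 * n) 0) - E₀)
      ≤ ∑ k : TorusSite 2 L, s / (L : ℝ) ^ 4 * (star ψ ⬝ᵥ (((upPairFieldAt dWaveFormFactor L k)ᴴ *
          upPairFieldAt dWaveFormFactor L k) *ᵥ ψ)).re := Finset.sum_le_sum fun k _ => hk k
    _ = s / (L : ℝ) ^ 4 * ∑ k : TorusSite 2 L, (star ψ ⬝ᵥ (((upPairFieldAt dWaveFormFactor L k)ᴴ *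
          upPairFieldAt dWaveFormFactor L k) *ᵥ ψ)).re := by rw [Finset.mul_sum]
    _ ≤ s / (L : ℝ) ^ 4 * (32 * (L : ℝ) ^ 4) :=
        mul_le_mul_of_nonneg_left (sum_re_expect_upPenalty_dWave_le L hψ1) (by positivity)
    _ = 32 * s := by
        rw [div_mul_eq_mul_div, show s * (32 * (L : ℝ) ^ 4) = (32 * s) * (L : ℝ) ^ 4 by ring,
          mul_div_assoc, div_self (ne_of_gt hL4), mul_one]

/-- `|(ℤ/L)²| = L²`. [folklore] -/
theorem card_torusSite_two' : Fintype.card (TorusSite 2 L) = L ^ 2 := by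
  simp [TorusSite, ZMod.card, Fintype.card_pi]

/-- **Some nonzero frame is cheap**: for `L ≥ 2`, `s ≥ 0`, `n ≤ L²` there is a pair momentum
`k ≠ 0` with `e(k) - E₀ ≤ 32 s / (L² - 1)` (pigeonhole on the orbit-averaged ceiling, every
summand being `≥ 0`). [folklore] -/
theorem exists_frameEnergy_sub_le (hL : 2 ≤ L) (U : ℝ) {s : ℝ} (hs : 0 ≤ s) {n : ℕ} (hn : n ≤ L ^ 2) :
    ∃ k : TorusSite 2 L, k ≠ 0 ∧
      (hubbardTorus 2 L 1 U + ((s / (L : ℝ) ^ 4 : ℝ) : ℂ) •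
          ((upPairFieldAt dWaveFormFactor L k)ᴴ * upPairFieldAt dWaveFormFactor L k)).minEnergyOn
          (szSector (2 * n) 0) -
        (hubbardTorus 2 L 1 U).minEnergyOn (szSector (2 * n) 0) ≤ 32 * s / ((L : ℝ) ^ 2 - 1) := by
  set f : TorusSite 2 L → ℝ := fun k =>
    (hubbardTorus 2 L 1 U + ((s / (L : ℝ) ^ 4 : ℝ) : ℂ) •
        ((upPairFieldAt dWaveFormFactor L k)ᴴ * upPairFieldAt dWaveFormFactor L k)).minEnergyOn
        (szSector (2 * n) 0) -
      (hubbardTorus 2 L 1 U).minEnergyOn (szSector (2 * n) 0) with hf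
  have hnonneg : ∀ k, 0 ≤ f k := fun k =>
    sub_nonneg.2 (minEnergyOn_le_minEnergyOn_penalisedAt L U hs k _ _)
  have hsum : ∑ k, f k ≤ 32 * s := sum_frameEnergy_sub_le L U hs hn
  -- the nonzero momenta
  have hcard : (Finset.univ.erase (0 : TorusSite 2 L)).card = L ^ 2 - 1 := by
    rw [Finset.card_erase_of_mem (Finset.mem_univ _), Finset.card_univ, card_torusSite_two']
  have hL2 : (1 : ℝ) < (L : ℝ) ^ 2 := by
    have : (2 : ℝ) ≤ L := by exact_mod_cast hL
    nlinarith
  have hne : (Finset.univ.erase (0 : TorusSite 2 L)).Nonempty := by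
    rw [← Finset.card_pos, hcard]
    have : 4 ≤ L ^ 2 := by nlinarith
    omega
  -- the minimum over `k ≠ 0` is at most the average
  obtain ⟨k, hk, hmin⟩ := Finset.exists_min_image (Finset.univ.erase (0 : TorusSite 2 L)) f hne
  refine ⟨k, Finset.ne_of_mem_erase hk, ?_⟩
  have hsum' : ∑ k ∈ Finset.univ.erase (0 : TorusSite 2 L), f k ≤ 32 * s := by
    have := Finset.sum_erase_add Finset.univ f (Finset.mem_univ (0 : TorusSite 2 L))
    linarith [hnonneg 0]
  have hge : ((L : ℝ) ^ 2 - 1) * f k ≤ ∑ k' ∈ Finset.univ.erase (0 : TorusSite 2 L), f k' := by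
    have h := Finset.card_nsmul_le_sum (Finset.univ.erase (0 : TorusSite 2 L)) f (f k)
      (fun k' hk' => hmin k' hk')
    rw [hcard, nsmul_eq_mul] at h
    have hc : (((L ^ 2 - 1 : ℕ) : ℝ)) = (L : ℝ) ^ 2 - 1 := by
      have : 1 ≤ L ^ 2 := Nat.one_le_pow _ _ (by omega)
      rw [Nat.cast_sub this]
      push_cast
      ring
    rwa [hc] at h
  rw [le_div_iff₀ (by linarith)]
  show f k * ((L : ℝ) ^ 2 - 1) ≤ 32 * s
  nlinarith

open Summit.HubbardSuperconductivity.HubbardSuperconductivity.Theses.DeformationLadder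
  Summit.HubbardSuperconductivity.HubbardSuperconductivity.Theorems.DeformationLadder in
/-- **`LadderThesis` pins some nonzero frame (converse, orbit-averaged form).** If the crux holds
with constants `(U, δ, s, a)`, then for all large even `L` SOME nonzero pair momentum `k` has frame
energy at least `(a/2)·s` below the zero frame: `e_L(k) + (a/2) s ≤ e_L(0)` — by the route's normal
form (`penaltyGap_of_ladderThesis`: `a s ≤ e_L(0) - E₀`) and the orbit-averaged ceiling
(`e_L(k) - E₀ ≤ 32 s/(L² - 1) ≤ (a/2) s` once `L² - 1 ≥ 64/a`). The all-`k` form (`FramePinning`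
of the card) is not implied: only the orbit AVERAGE of `e_L(k) - E₀` is controlled. [folklore] -/
theorem exists_pinnedFrame_of_ladderThesis (h : LadderThesis) :
    ∃ U : ℝ, 0 < U ∧ ∃ δ ∈ Set.Ioo (0:ℝ) (1 / 2), ∃ s : ℝ, 0 < s ∧ ∃ a : ℝ, 0 < a ∧ ∃ L₀ : ℕ,
      ∀ (L : ℕ) [NeZero L], L₀ ≤ L → Even L → ∃ k : TorusSite 2 L, k ≠ 0 ∧
        a * s ≤ (hubbardTorus 2 L 1 U + ((s / (L : ℝ) ^ 4 : ℝ) : ℂ) •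
              ((pairField dWaveFormFactor L)ᴴ * pairField dWaveFormFactor L)).minEnergyOn
              (szSector (2 * ⌊(1 - δ) * (L : ℝ) ^ 2 / 2⌋₊) 0) -
          (hubbardTorus 2 L 1 U + ((s / (L : ℝ) ^ 4 : ℝ) : ℂ) •
              ((upPairFieldAt dWaveFormFactor L k)ᴴ * upPairFieldAt dWaveFormFactor L k)).minEnergyOn
              (szSector (2 * ⌊(1 - δ) * (L : ℝ) ^ 2 / 2⌋₊) 0) := by
  obtain ⟨U, hU, δ, hδ, s, hs, a, ha, L₀, hgap⟩ := penaltyGap_of_ladderThesis h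
  -- `L² - 1 ≥ 64/a` as soon as `L ≥ ⌈64/a⌉ + 2`
  refine ⟨U, hU, δ, hδ, s, hs, a / 2, by positivity, max L₀ (⌈64 / a⌉₊ + 2), fun L _ hL hev => ?_⟩
  have hL₀ : L₀ ≤ L := (le_max_left _ _).trans hL
  have hL2 : 2 ≤ L := le_trans (by omega) ((le_max_right _ _).trans hL)
  have hLa : 64 / a ≤ (L : ℝ) ^ 2 - 1 := by
    have h1 : (⌈64 / a⌉₊ : ℝ) + 2 ≤ L := by exact_mod_cast (le_max_right _ _).trans hL
    have h2 : 64 / a ≤ ⌈64 / a⌉₊ := Nat.le_ceil _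
    nlinarith
  have hn : ⌊(1 - δ) * (L : ℝ) ^ 2 / 2⌋₊ ≤ L ^ 2 := by
    have hδ1 : (1 - δ) * (L : ℝ) ^ 2 / 2 ≤ (L : ℝ) ^ 2 := by
      have : 0 ≤ (L : ℝ) ^ 2 := by positivity
      nlinarith [hδ.1, hδ.2]
    exact_mod_cast (Nat.floor_le_floor hδ1).trans (by rw [show ((L : ℝ) ^ 2) = ((L ^ 2 : ℕ) : ℝ) by push_cast; ring, Nat.floor_natCast])
  obtain ⟨k, hk0, hk⟩ := exists_frameEnergy_sub_le L hL2 U hs.le hn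
  refine ⟨k, hk0, ?_⟩
  have hg := hgap L hL₀ hev
  -- `32 s/(L² - 1) ≤ (a/2) s`
  have hsmall : 32 * s / ((L : ℝ) ^ 2 - 1) ≤ a / 2 * s := by
    have hpos : 0 < (L : ℝ) ^ 2 - 1 := by
      have : (2 : ℝ) ≤ L := by exact_mod_cast hL2
      nlinarith
    rw [div_le_iff₀ hpos]
    have : 64 ≤ a * ((L : ℝ) ^ 2 - 1) := by
      have := (div_le_iff₀ ha).1 hLa
      linarith
    nlinarith
  linarith

end Summit.HubbardSuperconductivity.HubbardSuperconductivity.Theorems.PinnedFrame
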